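import Literature.Analysis.FluidPDE.Tao2016AveragedNS.RetunedFlow
import HarnessLib

/-!
# The retuned gate, certified: a `GateCertificate` for every member `delayCircuitWith K M ε`

HONEST FRAMING (pub-fluidc): a low prior, high value-of-information experiment on Tao's machine
paradigm; NOT a claim that Navier–Stokes blows up. Nothing in this file is about the fluid.

`GateCertificate.lean` packages Tao's delay circuit (5.5) — Theorem 5.3 as proved in the tree, its
trigger tolerance, global well-posedness and the fundamental lemma — into ONE inhabitant
`taoGate h : GateCertificate (Fin 5 → ℝ)` of the finite-dimensional half of the cell's local circuit
design (`FluidComputer/LocalCircuit.lean`), under a forcing budget `GateBudget K ε ρ εd θ`. This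
file does the same for EVERY MEMBER of the retuned family `delayCircuitWith K M ε`
(`GateRetuning.lean`; amplifier gain `ε⁻¹K¹⁰ ↦ ε⁻¹M`, seed `ε²e^{-K¹⁰} ↦ ε²e^{-M}`) in the range
`3000 log K ≤ M ≤ K¹⁰` of the family's Theorem 5.3 (`RetunedTransition.lean`,
`TriggerToleranceWith.lean`), using the flow / Lipschitz constant / firing-at-time-`2` theorems of
`RetunedFlow.lean`:

* §1 the INPUT CLASS `trigInWith K M ε ρ` (sup-`ρ`-neighbourhood of the segment of tolerated kicked
  data `kickInit κ`, `0 ≤ κ ≤ kickToleranceWith K M ε = ε²e^{-M}K¹⁰`) with its membership /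
  monotonicity / ball lemmas, `trigInWith_pow_ten_subset` (at `M = K¹⁰` it sits inside the input
  class `trigIn` of (5.5), `K ≥ 16`), and the energy confinement of its flow lines
  (`norm_delayFlowWith_le_of_mem_trigInWith`: radius `17/10` for `ρ ≤ 1/4`);
* §2 the BUDGET `GateBudgetWith K M ε ρ εd θ`: the standing hypotheses of the family's Theorem 5.3
  (`K ≥ 2·20⁴²·42! + 16`, `3000 log K ≤ M ≤ K¹⁰`, `0 < ε ≤ e^{-10M}/K¹⁰⁰`), `ρ > 0`, `εd ≥ 0`,
  `θ ≤ 1/4` and the Grönwall budget `(ρ + 2εd)·exp(2·delayLipschitzWith K M ε 2) ≤ θ`, with the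
  arithmetic consequences, the TUBE and the firing-with-margin theorem `GateBudgetWith.fired` AT THE
  FIXED RESCALED TIME `2` (uniform in `M`, by `outputOnset_le_two`);
* §3 the certificate `taoGateWith h : GateCertificate (Fin 5 → ℝ)` — regions `trigInWith K M ε ρ` ⊇
  core `trigInWith K M ε (ρ/2)`, output `firedOut 200 K θ`, field `delayCircuitWith K M ε`,
  `L = delayLipschitzWith K M ε 2` on the open sup-ball of radius `2`, flow `delayFlowWith K M ε`,
  `τc = 2`, defect `εd`, tube radius `θ - ρe^{2L}` — its `@[simp]` field lemmas, and
  `GateBudgetWith.exists_of` (budgets exist for every admissible `K, M, ε` and loss `0 < θ ≤ 1/4`);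
* §4 the NUMBERS: `ρ ≤ shadowRadiusWith K M ε 2 2 θ` and `shadowRadiusWith … < kickToleranceWith`
  (`2L ≥ 16M + 16/ε²`): as for (5.5), the certified input class of every member is far longer along
  the trigger axis than it is thick — the retuning makes the LENGTH polynomial (`ε²K^{10-p}` on
  `M = p log K`, `polySeedKickTolerance`) but leaves the THICKNESS `θe^{-O(ε⁻²)}` (the rotor is not
  retuned).

What bp3's `ReachCertificate.comp` / `LocalCircuit.gateCertificate` get from this file: a retuned
gate is a one-line, hypothesis-free input with every budget number explicit; on `M = p log K` every
number except `e^{2L}` is a power of `K`.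

No facts, no axioms, no `sorry`; two definitions (`trigInWith`, `taoGateWith`) and one
structure (`GateBudgetWith`).

References: T. Tao, *Finite time blowup for an averaged three-dimensional Navier–Stokes equation*,
J. Amer. Math. Soc. 29 (2016), §5.5, Theorem 5.3, (5.5)–(5.6), pp. 28–30 [Tao2016AveragedNS];
E. Hairer, S. Nørsett, G. Wanner, *Solving ODE I*, Thm I.10.2 [HairerNorsettWanner1993].
-/

namespace Literature.Analysis.FluidPDE.Tao2016AveragedNS

open Set Metric
open scoped NNReal

/-! ## §1. The input class of the member -/

/-- **Input class** of the member with thickness `ρ`: states within sup-distance `ρ` of a kicked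
datum `kickInit κ`, `0 ≤ κ ≤ kickToleranceWith K M ε`. [cite: Tao2016AveragedNS, §5.5 (5.6)] -/
noncomputable def trigInWith (K M ε ρ : ℝ) : Set (Fin 5 → ℝ) :=
  {p | ∃ κ : ℝ, 0 ≤ κ ∧ κ ≤ kickToleranceWith K M ε ∧ ‖p - kickInit κ‖ ≤ ρ}

/-- Membership in the input class, unfolded. [folklore] -/
theorem mem_trigInWith_iff {K M ε ρ : ℝ} {p : Fin 5 → ℝ} :
    p ∈ trigInWith K M ε ρ ↔
      ∃ κ : ℝ, 0 ≤ κ ∧ κ ≤ kickToleranceWith K M ε ∧ ‖p - kickInit κ‖ ≤ ρ := Iff.rfl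

/-- Kicked data below the family tolerance are admissible inputs. [cite: Tao2016AveragedNS, §5.5 (5.6)] -/
theorem kickInit_mem_trigInWith {K M ε ρ κ : ℝ} (hρ : 0 ≤ ρ) (hκ0 : 0 ≤ κ)
    (hκ : κ ≤ kickToleranceWith K M ε) : kickInit κ ∈ trigInWith K M ε ρ :=
  ⟨κ, hκ0, hκ, by simpa using hρ⟩

/-- The designed datum (5.6) is an admissible input of every member (`K, ε > 0`).
[cite: Tao2016AveragedNS, §5.5 (5.6)] -/
theorem delayInit_mem_trigInWith {K M ε ρ : ℝ} (hρ : 0 ≤ ρ) (hK : 0 < K) (hε : 0 < ε) :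
    delayInit ∈ trigInWith K M ε ρ := by
  rw [← kickInit_zero]
  exact kickInit_mem_trigInWith hρ le_rfl (kickToleranceWith_pos hK hε).le

/-- The input classes are monotone in the thickness. [folklore] -/
theorem trigInWith_mono {K M ε ρ ρ' : ℝ} (h : ρ ≤ ρ') : trigInWith K M ε ρ ⊆ trigInWith K M ε ρ' :=
  fun _ ⟨κ, hκ0, hκ, hp⟩ => ⟨κ, hκ0, hκ, hp.trans h⟩

/-- A `ρ'`-ball around a point of the `ρ`-class lies in the `(ρ + ρ')`-class. [folklore] -/
theorem ball_subset_trigInWith {K M ε ρ ρ' : ℝ} {p : Fin 5 → ℝ} (hp : p ∈ trigInWith K M ε ρ) :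
    Metric.ball p ρ' ⊆ trigInWith K M ε (ρ + ρ') := by
  obtain ⟨κ, hκ0, hκ, hpk⟩ := hp
  intro y hy
  refine ⟨κ, hκ0, hκ, ?_⟩
  rw [Metric.mem_ball, dist_eq_norm] at hy
  calc ‖y - kickInit κ‖ = ‖(y - p) + (p - kickInit κ)‖ := by congr 1; abel
    _ ≤ ‖y - p‖ + ‖p - kickInit κ‖ := norm_add_le _ _
    _ ≤ ρ + ρ' := by linarith

/-- At `M = K¹⁰` the member's input class lies inside the input class `trigIn` of (5.5) (`K ≥ 16`;
the family tolerance `ε²e^{-K¹⁰}K¹⁰` is below `kickTolerance K ε = ε²e^{-K¹⁰+K⁹√K/4}`,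
`kickToleranceWith_self_le`). [cite: Tao2016AveragedNS, §5.5 (5.6)] -/
theorem trigInWith_pow_ten_subset {K ε ρ : ℝ} (hK : 16 ≤ K) :
    trigInWith K (K ^ 10) ε ρ ⊆ trigIn K ε ρ :=
  fun _ ⟨κ, hκ0, hκ, hp⟩ => ⟨κ, hκ0, hκ.trans (kickToleranceWith_self_le hK), hp⟩

/-- Kicks below the family tolerance have `κ² ≤ 1` once `K¹⁰ε² ≤ 1`, `M ≥ 0`. [folklore] -/
theorem sq_le_one_of_le_kickToleranceWith {K M ε κ : ℝ} (hM : 0 ≤ M) (hKε : K ^ 10 * ε ^ 2 ≤ 1)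
    (hκ0 : 0 ≤ κ) (hκ : κ ≤ kickToleranceWith K M ε) : κ ^ 2 ≤ 1 := by
  have hexp : Real.exp (-M) ≤ 1 := Real.exp_le_one_iff.2 (by linarith)
  have h3 : κ ≤ 1 :=
    calc κ ≤ kickToleranceWith K M ε := hκ
      _ = ε ^ 2 * Real.exp (-M) * K ^ 10 := rfl
      _ ≤ ε ^ 2 * 1 * K ^ 10 := by gcongr
      _ = K ^ 10 * ε ^ 2 := by ring
      _ ≤ 1 := hKε
  exact pow_le_one₀ hκ0 h3

/-- States of the input class of thickness `ρ ≤ 1/4` have energy `≤ 2 + 10ρ² ≤ (17/10)²`, hence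
their flow lines (under ANY member) stay in the sup-ball of radius `17/10` (`K¹⁰ε² ≤ 1`, `M ≥ 0`).
[cite: Tao2016AveragedNS, §5.5 (energy-con)] -/
theorem norm_delayFlowWith_le_of_mem_trigInWith {K M ε ρ : ℝ} {p : Fin 5 → ℝ} (hM : 0 ≤ M)
    (hKε : K ^ 10 * ε ^ 2 ≤ 1) (hρ : ρ ≤ 1 / 4) (hp : p ∈ trigInWith K M ε ρ) (K' M' ε' σ : ℝ) :
    ‖delayFlowWith K' M' ε' σ p‖ ≤ 17 / 10 := by
  obtain ⟨κ, hκ0, hκ, hpk⟩ := hp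
  have hρ0 : 0 ≤ ρ := (norm_nonneg _).trans hpk
  have hE : energy p ≤ 2 + 10 * ρ ^ 2 :=
    energy_le_of_norm_sub_le (energy_kickInit (sq_le_one_of_le_kickToleranceWith hM hKε hκ0 hκ)) hpk
  have hE' : energy p ≤ (17 / 10) ^ 2 := by nlinarith
  exact (norm_delayFlowWith_le K' M' ε' p σ).trans ((Real.sqrt_le_left (by norm_num)).2 hE')

/-! ## §2. The forcing budget of the member -/

/-- **The forcing budget of the retuned gate**: the standing hypotheses of the family's Theorem 5.3
(`K ≥ 2·20⁴²·42! + 16`, `3000 log K ≤ M ≤ K¹⁰`, `0 < ε ≤ e^{-10M}/K¹⁰⁰`), an input thickness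
`ρ > 0`, an admissible defect `εd ≥ 0` per unit rescaled time, an efficiency loss `θ ≤ 1/4`, tied
by the GRÖNWALL BUDGET over the cycle `[0,2]` in the sup-ball of radius `2`:
`(ρ + 2εd)·exp(2·delayLipschitzWith K M ε 2) ≤ θ`. [cite: HairerNorsettWanner1993, Thm I.10.2] -/
structure GateBudgetWith (K M ε ρ εd θ : ℝ) : Prop where
  hK : 2 * 20 ^ 42 * (Nat.factorial 42 : ℝ) + 16 ≤ K
  hML : 3000 * Real.log K ≤ M
  hMK : M ≤ K ^ 10
  ε_pos : 0 < ε
  ε_le : ε ≤ Real.exp (-(10 * M)) / K ^ 100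
  ρ_pos : 0 < ρ
  εd_nonneg : 0 ≤ εd
  θ_le : θ ≤ 1 / 4
  budget : (ρ + εd * 2) * Real.exp (delayLipschitzWith K M ε 2 * 2) ≤ θ

namespace GateBudgetWith

variable {K M ε ρ εd θ : ℝ}

/-- A budget below the member's shadow radius is a gate budget. [cite: HairerNorsettWanner1993, Thm I.10.2] -/
theorem of_le_shadowRadiusWith (hK : 2 * 20 ^ 42 * (Nat.factorial 42 : ℝ) + 16 ≤ K)
    (hML : 3000 * Real.log K ≤ M) (hMK : M ≤ K ^ 10) (hε : 0 < ε)
    (hεle : ε ≤ Real.exp (-(10 * M)) / K ^ 100) (hρ : 0 < ρ) (hεd : 0 ≤ εd) (hθ : θ ≤ 1 / 4)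
    (h : ρ + εd * 2 ≤ shadowRadiusWith K M ε 2 2 θ) : GateBudgetWith K M ε ρ εd θ :=
  ⟨hK, hML, hMK, hε, hεle, hρ, hεd, hθ, budget_of_le_shadowRadiusWith h⟩

/-- The arithmetic of the standing hypotheses: `K ≥ 16`, `M ≥ 1`, `ε ≤ 1`, `169MK²⁰ε² ≤ 1`.
[folklore] -/
theorem facts (h : GateBudgetWith K M ε ρ εd θ) :
    16 ≤ K ∧ 1 ≤ M ∧ ε ≤ 1 ∧ 169 * M * K ^ 20 * ε ^ 2 ≤ 1 :=
  flow_params h.hK h.hML h.hMK h.ε_pos h.ε_le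

/-- `K ≥ 16`. [folklore] -/
theorem sixteen_le (h : GateBudgetWith K M ε ρ εd θ) : 16 ≤ K := h.facts.1

/-- `K ≥ 1`. [folklore] -/
theorem one_le (h : GateBudgetWith K M ε ρ εd θ) : 1 ≤ K := by linarith [h.sixteen_le]

/-- `M ≥ 0`. [folklore] -/
theorem M_nonneg (h : GateBudgetWith K M ε ρ εd θ) : 0 ≤ M := by linarith [h.facts.2.1]

/-- `ε ≤ 1`. [folklore] -/
theorem ε_le_one (h : GateBudgetWith K M ε ρ εd θ) : ε ≤ 1 := h.facts.2.2.1

/-- `K¹⁰ε² ≤ 1` (indeed `169MK²⁰ε² ≤ 1`). [folklore] -/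
theorem pow_ten_mul_sq_le_one (h : GateBudgetWith K M ε ρ εd θ) : K ^ 10 * ε ^ 2 ≤ 1 := by
  obtain ⟨h16, hM1, -, h169⟩ := h.facts
  have hK1 : 1 ≤ K := by linarith
  have hK10 : K ^ 10 ≤ K ^ 20 := pow_le_pow_right₀ hK1 (by norm_num)
  have hpos : 0 ≤ K ^ 20 * ε ^ 2 := by positivity
  calc K ^ 10 * ε ^ 2 ≤ K ^ 20 * ε ^ 2 := by gcongr
    _ = 1 * (K ^ 20 * ε ^ 2) := by ring
    _ ≤ 169 * M * (K ^ 20 * ε ^ 2) := mul_le_mul_of_nonneg_right (by linarith) hpos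
    _ = 169 * M * K ^ 20 * ε ^ 2 := by ring
    _ ≤ 1 := h169

/-- `e^{2L} ≥ 1`. [folklore] -/
theorem one_le_exp : 1 ≤ Real.exp (delayLipschitzWith K M ε 2 * 2) :=
  Real.one_le_exp (mul_nonneg (NNReal.coe_nonneg _) (by norm_num))

/-- `ρe^{2L} ≤ θ`. [folklore] -/
theorem ρ_mul_exp_le (h : GateBudgetWith K M ε ρ εd θ) :
    ρ * Real.exp (delayLipschitzWith K M ε 2 * 2) ≤ θ := by
  have hb := h.budget
  have hE := (one_le_exp (K := K) (M := M) (ε := ε))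
  nlinarith [h.εd_nonneg, h.ρ_pos]

/-- `ρ ≤ θ`. [folklore] -/
theorem ρ_le_θ (h : GateBudgetWith K M ε ρ εd θ) : ρ ≤ θ :=
  le_trans (le_mul_of_one_le_right h.ρ_pos.le one_le_exp) h.ρ_mul_exp_le

/-- `θ > 0`. [folklore] -/
theorem θ_pos (h : GateBudgetWith K M ε ρ εd θ) : 0 < θ := h.ρ_pos.trans_le h.ρ_le_θ

/-- `ρ ≤ 1/4`. [folklore] -/
theorem ρ_le_quarter (h : GateBudgetWith K M ε ρ εd θ) : ρ ≤ 1 / 4 := h.ρ_le_θ.trans h.θ_le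

/-- The tube radius of the certificate: `δsh = θ - ρe^{2L}` absorbs the defect. [folklore] -/
theorem defect_budget (h : GateBudgetWith K M ε ρ εd θ) :
    εd * 2 * Real.exp (delayLipschitzWith K M ε 2 * 2) ≤
      θ - ρ * Real.exp (delayLipschitzWith K M ε 2 * 2) := by
  have hb := h.budget
  rw [add_mul] at hb
  linarith

/-- The tube radius is non-negative. [folklore] -/
theorem δsh_nonneg (h : GateBudgetWith K M ε ρ εd θ) :
    0 ≤ θ - ρ * Real.exp (delayLipschitzWith K M ε 2 * 2) :=
  le_trans (by have := h.εd_nonneg; positivity) h.defect_budget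

/-- The tube radius is at most the efficiency loss. [folklore] -/
theorem δsh_le_θ (h : GateBudgetWith K M ε ρ εd θ) :
    θ - ρ * Real.exp (delayLipschitzWith K M ε 2 * 2) ≤ θ := by
  have : 0 ≤ ρ * Real.exp (delayLipschitzWith K M ε 2 * 2) := by have := h.ρ_pos; positivity
  linarith

/-- TUBE: flow lines from the input class, thickened by `δsh ≤ θ ≤ 1/4`, stay in the open sup-ball
of radius `2` (`17/10 + 1/4 < 2`). [cite: Tao2016AveragedNS, §5.5 (energy-con)] -/
theorem tube (h : GateBudgetWith K M ε ρ εd θ) {p : Fin 5 → ℝ} (hp : p ∈ trigInWith K M ε ρ)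
    (σ : ℝ) :
    Metric.closedBall (delayFlowWith K M ε σ p)
        (θ - ρ * Real.exp (delayLipschitzWith K M ε 2 * 2)) ⊆ Metric.ball 0 2 := by
  intro Y hY
  rw [Metric.mem_closedBall, dist_eq_norm] at hY
  rw [Metric.mem_ball, dist_zero_right]
  have h17 := norm_delayFlowWith_le_of_mem_trigInWith h.M_nonneg h.pow_ten_mul_sq_le_one
    h.ρ_le_quarter hp K M ε σ
  calc ‖Y‖ = ‖(Y - delayFlowWith K M ε σ p) + delayFlowWith K M ε σ p‖ := by congr 1; abel
    _ ≤ ‖Y - delayFlowWith K M ε σ p‖ + ‖delayFlowWith K M ε σ p‖ := norm_add_le _ _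
    _ < 2 := by linarith [h.δsh_le_θ, h.θ_le]

/-- **FIRED WITH MARGIN AT RESCALED TIME `2`, uniformly in `M`.** From every state of the input
class the member's flow reaches at `σ = 2` a point whose closed `δsh`-ball lies in the fired class
`firedOut 200 K θ` (the family's Theorem 5.3 for kicked data from time `2` on,
`kickTransitionWith_from_two`, + Grönwall between the two exact trajectories: `ρe^{2L} + δsh = θ`).
[cite: Tao2016AveragedNS, Theorem 5.3] -/
theorem fired (h : GateBudgetWith K M ε ρ εd θ) {p : Fin 5 → ℝ} (hp : p ∈ trigInWith K M ε ρ) :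
    Metric.closedBall (delayFlowWith K M ε 2 p)
        (θ - ρ * Real.exp (delayLipschitzWith K M ε 2 * 2)) ⊆ firedOut 200 K θ := by
  obtain ⟨κ, hκ0, hκ, hpk⟩ := hp
  set X : ℝ → Fin 5 → ℝ := fun t => delayFlowWith K M ε t (kickInit κ) with hXdef
  have hX : ∀ t, HasDerivAt X (delayCircuitWith K M ε (X t)) t :=
    hasDerivAt_delayFlowWith K M ε (kickInit κ)
  have hX0 : X 0 = kickInit κ := delayFlowWith_zero K M ε _
  have hκsq : κ ^ 2 ≤ 1 :=
    sq_le_one_of_le_kickToleranceWith h.M_nonneg h.pow_ten_mul_sq_le_one hκ0 hκ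
  have hX1 : ∀ t, ‖X t‖ ≤ 1 := kickW_norm_le_one hX hX0 hκsq
  intro Y hY
  rw [Metric.mem_closedBall, dist_eq_norm] at hY
  -- Grönwall between the two exact trajectories from `p` and from `kickInit κ`, at time `2`
  have hP1 : ∀ t, ‖delayFlowWith K M ε t p‖ ≤ ((2 : ℝ≥0) : ℝ) := fun t =>
    (norm_delayFlowWith_le_of_mem_trigInWith h.M_nonneg h.pow_ten_mul_sq_le_one h.ρ_le_quarter
      ⟨κ, hκ0, hκ, hpk⟩ K M ε t).trans (by norm_num)
  have hPpo : IsPseudoOrbit (delayCircuitWith K M ε) 0 2 2 (fun t => delayFlowWith K M ε t p) :=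
    IsPseudoOrbit.of_hasDerivAt (hasDerivAt_delayFlowWith K M ε p) fun t _ => hP1 t
  have hXpo : IsPseudoOrbit (delayCircuitWith K M ε) 0 2 2 X :=
    IsPseudoOrbit.of_hasDerivAt hX fun t _ => (hX1 t).trans (by norm_num)
  have h00 : ‖delayFlowWith K M ε 0 p - X 0‖ ≤ ρ := by rwa [delayFlowWith_zero, hX0]
  have hgr := hPpo.norm_sub_le (lipschitzOnWith_delayCircuitWith K M ε 2) hXpo h00
    (t := 2) ⟨by norm_num, le_rfl⟩
  rw [add_zero, gronwallBound_ε0] at hgr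
  -- total distance of `Y` from the reference at time `2` is `≤ θ`
  have hYX : ‖Y - X 2‖ ≤ θ := by
    calc ‖Y - X 2‖ = ‖(Y - delayFlowWith K M ε 2 p) + (delayFlowWith K M ε 2 p - X 2)‖ := by
          congr 1; abel
      _ ≤ ‖Y - delayFlowWith K M ε 2 p‖ + ‖delayFlowWith K M ε 2 p - X 2‖ := norm_add_le _ _
      _ ≤ (θ - ρ * Real.exp (delayLipschitzWith K M ε 2 * 2)) +
            ρ * Real.exp (delayLipschitzWith K M ε 2 * 2) := add_le_add hY hgr
      _ = θ := by ring
  obtain ⟨h4, hi⟩ := kickTransitionWith_from_two h.hK h.hML h.hMK h.ε_pos h.ε_le hκ0 hκ hX0 hX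
    (t := 2) le_rfl
  refine ⟨?_, fun i hne => abs_le_of_norm_sub_le hYX (hi i hne)⟩
  have := (abs_sub_le_iff.1 (abs_sub_le_of_norm_sub_le hYX h4)).2
  linarith

/-- The `dat` field of the certificate: a firing instant in `[0, 2]` (namely `2`).
[cite: Tao2016AveragedNS, Theorem 5.3] -/
theorem dat (h : GateBudgetWith K M ε ρ εd θ) {p : Fin 5 → ℝ} (hp : p ∈ trigInWith K M ε ρ) :
    ∃ σ : ℝ, 0 ≤ σ ∧ σ ≤ 2 ∧
      Metric.closedBall (delayFlowWith K M ε σ p)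
          (θ - ρ * Real.exp (delayLipschitzWith K M ε 2 * 2)) ⊆ firedOut 200 K θ :=
  ⟨2, by norm_num, le_rfl, h.fired hp⟩

end GateBudgetWith

/-! ## §3. The certificate of the retuned gate -/

/-- **THE RETUNED GATE, CERTIFIED.** Under a budget `GateBudgetWith K M ε ρ εd θ` the member
`delayCircuitWith K M ε` inhabits the finite-dimensional half of the cell's local circuit design over
`O = ℝ⁵` (sup norm) with: input class `trigInWith K M ε ρ` (core = thickness `ρ/2`, core thickness
`δ = ρ/2`), output class `firedOut 200 K θ`, design field `delayCircuitWith K M ε`, working region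
the open sup-ball of radius `2` with Lipschitz constant `delayLipschitzWith K M ε 2`, flow
`delayFlowWith K M ε`, cycle time `τc = 2` (uniform in `M`), admissible defect `εd`, tube radius
`δsh = θ - ρ·exp(2·delayLipschitzWith K M ε 2)` — every field a theorem of this directory.
[cite: Tao2016AveragedNS, Theorem 5.3] -/
noncomputable def taoGateWith {K M ε ρ εd θ : ℝ} (h : GateBudgetWith K M ε ρ εd θ) :
    GateCertificate (Fin 5 → ℝ) where
  Ain := trigInWith K M ε ρ
  Acore := trigInWith K M ε (ρ / 2)
  Aout := firedOut 200 K θ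
  δ := ρ / 2
  δ_pos := half_pos h.ρ_pos
  core_thick := fun p hp => by
    have := ball_subset_trigInWith (ρ' := ρ / 2) hp
    rwa [add_halves] at this
  F := delayCircuitWith K M ε
  U := Metric.ball 0 2
  U_open := Metric.isOpen_ball
  L := delayLipschitzWith K M ε 2
  F_lip := (lipschitzOnWith_delayCircuitWith K M ε 2).mono Metric.ball_subset_closedBall
  Φ := delayFlowWith K M ε
  τc := 2
  τc_nonneg := by norm_num
  flow_zero := fun p _ => delayFlowWith_zero K M ε p
  flow_cont := fun p _ => (continuous_delayFlowWith K M ε p).continuousOn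
  flow_deriv := fun p _ σ _ => (hasDerivAt_delayFlowWith K M ε p σ).hasDerivWithinAt
  ε := εd
  ε_nonneg := h.εd_nonneg
  δsh := θ - ρ * Real.exp (delayLipschitzWith K M ε 2 * 2)
  δsh_ge := Literature.Analysis.FluidPDE.FluidComputer.gronwallBound_le_of_budget
    (NNReal.coe_nonneg _) h.εd_nonneg h.defect_budget
  tube := fun p hp σ _ => h.tube hp σ
  dat := fun p hp => h.dat hp

namespace taoGateWith
variable {K M ε ρ εd θ : ℝ} (h : GateBudgetWith K M ε ρ εd θ)

/-- Input class of the certified retuned gate. [cite: Tao2016AveragedNS, §5.5 (5.6)] -/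
@[simp] theorem Ain_eq : (taoGateWith h).Ain = trigInWith K M ε ρ := rfl

/-- Core class of the certified retuned gate. [cite: Tao2016AveragedNS, §5.5 (5.6)] -/
@[simp] theorem Acore_eq : (taoGateWith h).Acore = trigInWith K M ε (ρ / 2) := rfl

/-- Output class of the certified retuned gate. [cite: Tao2016AveragedNS, Theorem 5.3] -/
@[simp] theorem Aout_eq : (taoGateWith h).Aout = firedOut 200 K θ := rfl

/-- Core thickness of the certified retuned gate: `ρ/2`. [folklore] -/
@[simp] theorem δ_eq : (taoGateWith h).δ = ρ / 2 := rfl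

/-- Design field of the certified retuned gate: the member. [cite: Tao2016AveragedNS, §5.5 (5.5)] -/
@[simp] theorem F_eq : (taoGateWith h).F = delayCircuitWith K M ε := rfl

/-- Working region: the open sup-ball of radius `2`. [folklore] -/
@[simp] theorem U_eq : (taoGateWith h).U = Metric.ball 0 2 := rfl

/-- Lipschitz constant: `delayLipschitzWith K M ε 2`. [cite: Tao2016AveragedNS, §5.5 (5.5)] -/
@[simp] theorem L_eq : (taoGateWith h).L = delayLipschitzWith K M ε 2 := rfl

/-- Flow: `delayFlowWith K M ε`. [cite: Tao2016AveragedNS, §5.5 (5.5)] -/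
@[simp] theorem Φ_eq : (taoGateWith h).Φ = delayFlowWith K M ε := rfl

/-- Rescaled cycle time: `2`, for every member. [cite: Tao2016AveragedNS, Theorem 5.3] -/
@[simp] theorem τc_eq : (taoGateWith h).τc = 2 := rfl

/-- Admissible defect: `εd`. [folklore] -/
@[simp] theorem ε_eq : (taoGateWith h).ε = εd := rfl

/-- Tube radius: `θ - ρe^{2L}`. [folklore] -/
@[simp] theorem δsh_eq :
    (taoGateWith h).δsh = θ - ρ * Real.exp (delayLipschitzWith K M ε 2 * 2) := rfl

/-- The designed datum (5.6) is a loaded-core input. [cite: Tao2016AveragedNS, §5.5 (5.6)] -/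
theorem delayInit_mem_Acore : delayInit ∈ (taoGateWith h).Acore :=
  delayInit_mem_trigInWith (half_pos h.ρ_pos).le (by linarith [h.sixteen_le]) h.ε_pos

/-- So is every tolerated kicked datum. [cite: Tao2016AveragedNS, §5.5 (5.6)] -/
theorem kickInit_mem_Acore {κ : ℝ} (hκ0 : 0 ≤ κ) (hκ : κ ≤ kickToleranceWith K M ε) :
    kickInit κ ∈ (taoGateWith h).Acore :=
  kickInit_mem_trigInWith (half_pos h.ρ_pos).le hκ0 hκ

/-- At time `τc = 2` the flow line of every tolerated kicked datum has fired (no margin needed).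
[cite: Tao2016AveragedNS, Theorem 5.3] -/
theorem Φ_kickInit_fired {κ : ℝ} (hκ0 : 0 ≤ κ) (hκ : κ ≤ kickToleranceWith K M ε) :
    |(taoGateWith h).Φ 2 (kickInit κ) 4 - 1| ≤ 200 / K ^ 10 ∧
      ∀ i : Fin 5, i ≠ 4 → |(taoGateWith h).Φ 2 (kickInit κ) i| ≤ 200 / K ^ 10 :=
  delayFlowWith_kickInit_fires h.hK h.hML h.hMK h.ε_pos h.ε_le hκ0 hκ le_rfl

end taoGateWith

/-- **Budgets exist** for every admissible `K, M, ε` and every loss `0 < θ ≤ 1/4`: take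
`ρ = 2εd = shadowRadiusWith K M ε 2 2 θ / 2`. [cite: HairerNorsettWanner1993, Thm I.10.2] -/
theorem GateBudgetWith.exists_of {K M ε θ : ℝ} (hK : 2 * 20 ^ 42 * (Nat.factorial 42 : ℝ) + 16 ≤ K)
    (hML : 3000 * Real.log K ≤ M) (hMK : M ≤ K ^ 10) (hε : 0 < ε)
    (hεle : ε ≤ Real.exp (-(10 * M)) / K ^ 100) (hθ0 : 0 < θ) (hθ : θ ≤ 1 / 4) :
    ∃ ρ εd : ℝ, 0 < ρ ∧ 0 < εd ∧ GateBudgetWith K M ε ρ εd θ := by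
  have hS : 0 < shadowRadiusWith K M ε 2 2 θ := by unfold shadowRadiusWith; positivity
  refine ⟨shadowRadiusWith K M ε 2 2 θ / 2, shadowRadiusWith K M ε 2 2 θ / 4, by positivity,
    by positivity, GateBudgetWith.of_le_shadowRadiusWith hK hML hMK hε hεle (by positivity)
      (by positivity) hθ (le_of_eq ?_)⟩
  ring

/-! ## §4. The numbers: thin and long, for every member -/

/-- Thickness: a budget forces `ρ ≤ shadowRadiusWith K M ε 2 2 θ = θ·exp(-2·delayLipschitzWith K M ε 2)`
(`≤ θe^{-16/ε²}`, `shadowRadiusWith_le`). [cite: HairerNorsettWanner1993, Thm I.10.2] -/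
theorem GateBudgetWith.ρ_le_shadowRadiusWith {K M ε ρ εd θ : ℝ} (h : GateBudgetWith K M ε ρ εd θ) :
    ρ ≤ shadowRadiusWith K M ε 2 2 θ := by
  have hb := h.ρ_mul_exp_le
  have hE := Real.exp_pos (delayLipschitzWith K M ε 2 * 2)
  unfold shadowRadiusWith
  rw [Real.exp_neg, ← div_eq_mul_inv]
  exact (le_div_iff₀ hE).2 hb

/-- Length versus thickness, for every member: `shadowRadiusWith K M ε 2 2 θ < kickToleranceWith K M ε`
for `θ ≤ 1`, `0 < ε ≤ 1`, `K ≥ 1`, `M ≥ 0` — indeed `2·delayLipschitzWith K M ε 2 ≥ 16M + 16/ε²`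
while the tolerance is `ε²e^{-M}K¹⁰ ≥ ε²e^{-M}`, and `e^{-16/ε²} < ε²`. The retuning makes the
LENGTH of the certified input class polynomial on `M = p log K` (`polySeedKickTolerance`) but not
its THICKNESS. [cite: Tao2016AveragedNS, §5.5 proof of Theorem 5.3] -/
theorem shadowRadiusWith_lt_kickToleranceWith {K M ε θ : ℝ} (hK : 1 ≤ K) (hM : 0 ≤ M)
    (hε : 0 < ε) (hε1 : ε ≤ 1) (hθ : θ ≤ 1) :
    shadowRadiusWith K M ε 2 2 θ < kickToleranceWith K M ε := by
  have hK0 : 0 ≤ K := by linarith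
  have hK10 : 1 ≤ K ^ 10 := one_le_pow₀ hK
  -- lower bound for the exponent `2L ≥ 16M + 16/ε²`
  have hL : 16 * M + 16 / ε ^ 2 ≤ delayLipschitzWith K M ε 2 * 2 := by
    rw [coe_delayLipschitzWith hK0 hM hε]
    push_cast
    have h1 : M ≤ ε⁻¹ * M := by
      have : 1 ≤ ε⁻¹ := one_le_inv_iff₀.2 ⟨hε, hε1⟩
      nlinarith
    have h2 : 0 ≤ ε + ε ^ 2 * Real.exp (-M) + K := by positivity
    have h3 : 16 / ε ^ 2 = 16 * (ε ^ 2)⁻¹ := by ring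
    rw [h3]
    nlinarith [inv_nonneg.2 (sq_nonneg ε)]
  -- `e^{-16/ε²} < ε²`
  have hεsq : 0 < ε ^ 2 := by positivity
  have hlog : -(16 / ε ^ 2) < Real.log (ε ^ 2) := by
    have hl : Real.log (ε ^ 2)⁻¹ ≤ (ε ^ 2)⁻¹ - 1 := Real.log_le_sub_one_of_pos (inv_pos.2 hεsq)
    rw [Real.log_inv] at hl
    have : (ε ^ 2)⁻¹ - 1 < 16 / ε ^ 2 := by
      rw [div_eq_mul_inv]; nlinarith [inv_pos.2 hεsq]
    linarith
  have hkey : Real.exp (-(16 / ε ^ 2)) < ε ^ 2 := by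
    calc Real.exp (-(16 / ε ^ 2)) < Real.exp (Real.log (ε ^ 2)) := Real.exp_lt_exp.2 hlog
      _ = ε ^ 2 := Real.exp_log hεsq
  have hθ' : shadowRadiusWith K M ε 2 2 θ ≤ Real.exp (-(delayLipschitzWith K M ε 2 * 2)) := by
    unfold shadowRadiusWith
    exact (mul_le_of_le_one_left (Real.exp_pos _).le hθ)
  have hsplit : Real.exp (-(delayLipschitzWith K M ε 2 * 2)) ≤
      Real.exp (-(16 / ε ^ 2)) * Real.exp (-M) := by
    rw [← Real.exp_add]
    refine Real.exp_le_exp.2 ?_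
    nlinarith
  calc shadowRadiusWith K M ε 2 2 θ ≤ Real.exp (-(delayLipschitzWith K M ε 2 * 2)) := hθ'
    _ ≤ Real.exp (-(16 / ε ^ 2)) * Real.exp (-M) := hsplit
    _ < ε ^ 2 * Real.exp (-M) := mul_lt_mul_of_pos_right hkey (Real.exp_pos _)
    _ = ε ^ 2 * Real.exp (-M) * 1 := (mul_one _).symm
    _ ≤ ε ^ 2 * Real.exp (-M) * K ^ 10 := by gcongr
    _ = kickToleranceWith K M ε := rfl

/-- Hence under a budget the member's input class is longer along the trigger axis than it is thick:
`ρ < kickToleranceWith K M ε`. [cite: Tao2016AveragedNS, §5.5 proof of Theorem 5.3] -/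
theorem GateBudgetWith.ρ_lt_kickToleranceWith {K M ε ρ εd θ : ℝ} (h : GateBudgetWith K M ε ρ εd θ) :
    ρ < kickToleranceWith K M ε :=
  h.ρ_le_shadowRadiusWith.trans_lt
    (shadowRadiusWith_lt_kickToleranceWith h.one_le h.M_nonneg h.ε_pos h.ε_le_one
      (h.θ_le.trans (by norm_num)))

end Literature.Analysis.FluidPDE.Tao2016AveragedNS
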